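import Mathlib
import Literature.Probability.Percolation.BondPercolationSymmetry
import Literature.Probability.Percolation.BondPercolationBlockIndependence
import Literature.Probability.Percolation.FiniteEnergy
import Literature.Probability.Percolation.SharpnessDCTProofs
import Literature.Probability.Percolation.LatticeSymmetry
import Literature.Barriers.CriticalPhenomena.KozmaNachmiasLemma11Steps

/-!
# Crux `PercNonProliferation.FreeBoxSparse` (stmt-CriticalPhenomena-4445), line
# `ccfs-window-kissing-walls` — stub `stub_boost` (BOOSTED GIANTS)

Helper file for the lead's checked skeleton of the line `ccfs-window-kissing-walls`
(prover-line-stmt-CriticalPhenomena-4445-0). Proves exactly the registered stub signature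
`stub_boost`; lands with `--supports stmt-CriticalPhenomena-4445`. Self-contained over the
`Literature` percolation library (every `p`, no thesis-level vocabulary).

**Statement.** Write `Λ_n = box 3 n`, `FA₂(p, n) = |Λ_n|⁻² Σ_{x,y∈Λ_n} P_p(x ↔ y in Λ_n)` and, for a
finite `Λ ⊂ ℤ³`, `Dense_t(Λ) = {∃ x ∈ Λ, #{v ∈ Λ | x ↔ v in Λ} ≥ t}` ("some free piece of `Λ` has at
least `t` vertices"). If `FA₂(p, n) ≥ η > 0` for infinitely many `n`, then for every `ε > 0` there is
`δ > 0` such that, for infinitely many `n` and all three directions `i` at once,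
`P_p(Dense_{δ|Λ_n|}(Λ_n) ∩ Dense_{δ|Λ_n|}(Λ_n + (2n+1)eᵢ)) ≥ 1 - ε`.

**Proof.** First moment (`sum_sum_measureReal_le`): `Σ_{x,y} P(x ↔ y in Λ) ≤ |Λ| t + |Λ|² P(Dense_t)`,
so `FA₂ ≥ η` gives `P(Dense_{(η/2)|Λ_n|}(Λ_n)) ≥ η/2`. `Dense_t` is monotone in `Λ` (`dense_mono`),
reads only the pairs inside `Λ` (`determinedBy_dense`) and is translation invariant in law
(`real_compl_dense_image_add`, from `bondPercolation_real_preimage_shift`). Boosting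
(`real_compl_dense_bigBox_le`): for `N = (2j+1)n + j` the `(2j+1)³` translates `Λ_n + (2n+1)w`,
`w ∈ Λ_j`, are pairwise disjoint and lie in `Λ_N`; their "no `t`-piece" events are mutually
independent (`bondPercolation_iIndep_edgeSigma`), equiprobable, and contain the "no `t`-piece" event
of `Λ_N`, whence `P(¬Dense_t(Λ_N)) ≤ P(¬Dense_t(Λ_n))^{|Λ_j|} ≤ θ^{|Λ_j|}`, `θ = max(1 - η/2, 0) < 1`;
the adjacent box `Λ_N + (2N+1)eᵢ` has the same bound (translation). Union bound with
`θ^{|Λ_j|} ≤ ε/2` and `δ = η/(2(2j+1)³)` (`δ|Λ_N| = (η/2)|Λ_n|`); the boosted scales `N ≥ n` of a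
frequent set of `n` are frequent. No new definitions: events are spelled out as registered.
-/

noncomputable section

namespace Summit.CriticalPhenomena.PercolationContinuityZ3.Theorems.FreeBoxSparse

open MeasureTheory Filter
open Literature.Probability.Percolation Literature.Probability.LatticeModels
open scoped Topology Classical

namespace StubBoost

variable {V : Type*}

/-! ### The dense-piece event of a finite vertex set -/

/-- A piece of a sub-box lies in a piece of the box: the dense-piece event is monotone in the
vertex set. [folklore] -/
theorem dense_mono {Λ Λ' : Finset V} (h : Λ ⊆ Λ') (t : ℝ) :
    {ω : BondConfig V | ∃ x ∈ Λ, t ≤ ((Λ.filter fun v => ω ∈ openConnIn ↑Λ x v).card : ℝ)} ⊆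
      {ω | ∃ x ∈ Λ', t ≤ ((Λ'.filter fun v => ω ∈ openConnIn ↑Λ' x v).card : ℝ)} := by
  rintro ω ⟨x, hx, ht⟩
  refine ⟨x, h hx, ht.trans ?_⟩
  exact_mod_cast Finset.card_le_card fun v hv => by
    rw [Finset.mem_filter] at hv ⊢
    exact ⟨h hv.1, DCT16.mem_openConnIn_of_pathIn
      ((DCT16.pathIn_of_mem_openConnIn hv.2).mono (Finset.coe_subset.2 h))⟩

/-- The dense-piece event of `Λ` only reads the pairs inside `Λ`. [folklore] -/
theorem determinedBy_dense (Λ : Finset V) (t : ℝ) :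
    DeterminedBy
      {ω : BondConfig V | ∃ x ∈ Λ, t ≤ ((Λ.filter fun v => ω ∈ openConnIn ↑Λ x v).card : ℝ)}
      (↑Λ.sym2 : Set (Sym2 V)) := by
  rw [determinedBy_iff]
  intro ω ω' h
  have key : ∀ x v, ω ∈ openConnIn (↑Λ : Set V) x v ↔ ω' ∈ openConnIn (↑Λ : Set V) x v :=
    fun x v => (determinedBy_iff _ _).1 (DCT16.determinedBy_openConnIn (↑Λ : Set V) x v
      (K := (↑Λ.sym2 : Set (Sym2 V))) (by rw [Finset.coe_sym2])) ω ω' h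
  simp only [Set.mem_setOf_eq, key]

/-- The dense-piece event is measurable. [folklore] -/
theorem measurableSet_dense (Λ : Finset V) (t : ℝ) :
    MeasurableSet
      {ω : BondConfig V | ∃ x ∈ Λ, t ≤ ((Λ.filter fun v => ω ∈ openConnIn ↑Λ x v).card : ℝ)} :=
  (determinedBy_dense Λ t).measurableSet_of_finset

/-! ### Independence over pairwise disjoint vertex sets -/

/-- **Product formula**: the "no piece with `≥ t` vertices" events of pairwise disjoint finite
vertex sets are mutually independent under `P_p` (they read pairwise disjoint sets of pairs;
Grimmett 1999, §1.3, product measure). [folklore] -/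
theorem real_biInter_compl_dense [Countable V] (G : SimpleGraph V) (p : unitInterval) {ι : Type*}
    (I : Finset ι) (Λ : ι → Finset V) (hΛ : Pairwise fun a b => Disjoint (Λ a) (Λ b)) (t : ℝ) :
    (bondPercolation G p).real (⋂ a ∈ I,
        {ω : BondConfig V | ∃ x ∈ Λ a,
          t ≤ (((Λ a).filter fun v => ω ∈ openConnIn ↑(Λ a) x v).card : ℝ)}ᶜ) =
      ∏ a ∈ I, (bondPercolation G p).real
        {ω : BondConfig V | ∃ x ∈ Λ a,
          t ≤ (((Λ a).filter fun v => ω ∈ openConnIn ↑(Λ a) x v).card : ℝ)}ᶜ := by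
  have hS : Pairwise fun a b => Disjoint (↑(Λ a).sym2 : Set (Sym2 V)) ↑(Λ b).sym2 := by
    intro a b hab
    rw [Finset.disjoint_coe, Finset.disjoint_left]
    refine Sym2.ind (fun x y hx hx' => ?_)
    rw [Finset.mk_mem_sym2_iff] at hx hx'
    exact Finset.disjoint_left.1 (hΛ hab) hx.1 hx'.1
  have hind := bondPercolation_iIndep_edgeSigma G p (fun a => (↑(Λ a).sym2 : Set (Sym2 V))) hS
  have h := hind.meas_biInter (S := I)
    (s := fun a => {ω : BondConfig V | ∃ x ∈ Λ a,
      t ≤ (((Λ a).filter fun v => ω ∈ openConnIn ↑(Λ a) x v).card : ℝ)}ᶜ)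
    fun a _ => ((determinedBy_dense (Λ a) t).measurableSet_edgeSigma
      (measurableSet_dense (Λ a) t)).compl
  simp only [measureReal_def]
  rw [← ENNReal.toReal_prod]
  exact congrArg ENNReal.toReal h

/-! ### Translation invariance of the dense-piece event -/

variable {d : ℕ}

/-- Translating the vertex set translates the dense-piece event: its pull-back under
`ω ↦ ω + v` is the dense-piece event of the original set. [folklore] -/
theorem preimage_relabel_shift_dense (v : Site d) (Λ : Finset (Site d)) (t : ℝ) :
    BondConfig.relabel (sym2Equiv (Site.shift v)) ⁻¹'
        {ω | ∃ x ∈ Λ.image (· + v), t ≤ (((Λ.image (· + v)).filter fun y =>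
          ω ∈ openConnIn ↑(Λ.image (· + v)) x y).card : ℝ)} =
      {ω | ∃ x ∈ Λ, t ≤ ((Λ.filter fun y => ω ∈ openConnIn ↑Λ x y).card : ℝ)} := by
  ext ω
  have hcoe : (↑(Λ.image (· + v)) : Set (Site d)) = (Site.shift v) '' ↑Λ := by
    rw [Finset.coe_image]; rfl
  have key : ∀ x y : Site d, BondConfig.relabel (sym2Equiv (Site.shift v)) ω ∈
      openConnIn (↑(Λ.image (· + v)) : Set (Site d)) (x + v) (y + v) ↔
        ω ∈ openConnIn (↑Λ : Set (Site d)) x y := by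
    intro x y
    have h := Set.ext_iff.1 (Literature.Barriers.CriticalPhenomena.preimage_relabel_openConnIn
      (Site.shift v) (↑Λ : Set (Site d)) x y) ω
    rwa [Set.mem_preimage, Site.shift_apply, Site.shift_apply, ← hcoe] at h
  have hcard : ∀ x : Site d, ((Λ.image (· + v)).filter fun y =>
      BondConfig.relabel (sym2Equiv (Site.shift v)) ω ∈
        openConnIn (↑(Λ.image (· + v)) : Set (Site d)) (x + v) y).card =
      (Λ.filter fun y => ω ∈ openConnIn (↑Λ : Set (Site d)) x y).card := by
    intro x
    rw [Finset.filter_image, Finset.card_image_of_injective _ (add_left_injective v)]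
    exact congrArg Finset.card (Finset.filter_congr fun y _ => key x y)
  constructor
  · rintro ⟨x', hx', ht⟩
    obtain ⟨x, hx, rfl⟩ := Finset.mem_image.1 hx'
    exact ⟨x, hx, by rw [← hcard x]; exact ht⟩
  · rintro ⟨x, hx, ht⟩
    exact ⟨x + v, Finset.mem_image_of_mem _ hx, by rw [hcard x]; exact ht⟩

/-- **Translation invariance** of the "no piece with `≥ t` vertices" probability
(Grimmett 1999, §1.6). [folklore] -/
theorem real_compl_dense_image_add (p : unitInterval) (v : Site d) (Λ : Finset (Site d)) (t : ℝ) :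
    (bondPercolation (zdGraph d) p).real
        {ω | ∃ x ∈ Λ.image (· + v), t ≤ (((Λ.image (· + v)).filter fun y =>
          ω ∈ openConnIn ↑(Λ.image (· + v)) x y).card : ℝ)}ᶜ =
      (bondPercolation (zdGraph d) p).real
        {ω | ∃ x ∈ Λ, t ≤ ((Λ.filter fun y => ω ∈ openConnIn ↑Λ x y).card : ℝ)}ᶜ := by
  rw [← preimage_relabel_shift_dense v Λ t, ← Set.preimage_compl,
    bondPercolation_real_preimage_shift]

/-! ### Tiling a box by translates of a smaller box -/

/-- For `w ∈ B(j)`, the translate `B(n) + (2n+1)w` lies in `B((2j+1)n + j)`. [folklore] -/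
theorem image_box_add_subset {n j : ℕ} {w : Site d} (hw : w ∈ box d j) :
    (box d n).image (· + fun i => (2 * (n : ℤ) + 1) * w i) ⊆ box d ((2 * j + 1) * n + j) := by
  intro y hy
  obtain ⟨x, hx, rfl⟩ := Finset.mem_image.1 hy
  rw [mem_box] at hx hw ⊢
  intro i
  obtain ⟨hx1, hx2⟩ := hx i
  obtain ⟨hw1, hw2⟩ := hw i
  have h0 : (0 : ℤ) ≤ 2 * n + 1 := by positivity
  have h1 : (2 * (n : ℤ) + 1) * w i ≤ (2 * n + 1) * j := mul_le_mul_of_nonneg_left hw2 h0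
  have h2 : (2 * (n : ℤ) + 1) * -(j : ℤ) ≤ (2 * n + 1) * w i := mul_le_mul_of_nonneg_left hw1 h0
  simp only [Pi.add_apply]
  push_cast
  constructor <;> linarith

/-- Distinct translates `B(n) + (2n+1)w ≠ B(n) + (2n+1)w'` are disjoint. [folklore] -/
theorem disjoint_image_box_add (n : ℕ) {w w' : Site d} (hne : w ≠ w') :
    Disjoint ((box d n).image (· + fun i => (2 * (n : ℤ) + 1) * w i))
      ((box d n).image (· + fun i => (2 * (n : ℤ) + 1) * w' i)) := by
  rw [Finset.disjoint_left]
  intro y hy hy'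
  obtain ⟨x, hx, rfl⟩ := Finset.mem_image.1 hy
  obtain ⟨x', hx', hxx'⟩ := Finset.mem_image.1 hy'
  obtain ⟨i, hi⟩ := Function.ne_iff.1 hne
  have h := congrFun hxx' i
  simp only [Pi.add_apply] at h
  rw [mem_box] at hx hx'
  obtain ⟨hx1, hx2⟩ := hx i
  obtain ⟨hx1', hx2'⟩ := hx' i
  have h0 : (0 : ℤ) ≤ 2 * n + 1 := by positivity
  rcases lt_or_gt_of_ne hi with hlt | hlt
  · have := mul_le_mul_of_nonneg_left (show w i + 1 ≤ w' i by omega) h0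
    linarith
  · have := mul_le_mul_of_nonneg_left (show w' i + 1 ≤ w i by omega) h0
    linarith

/-- `|B((2j+1)n + j)| = (2j+1)³ |B(n)|` (`2N+1 = (2j+1)(2n+1)`). [folklore] -/
theorem card_bigBox (n j : ℕ) :
    ((box 3 ((2 * j + 1) * n + j)).card : ℝ) = (2 * (j : ℝ) + 1) ^ 3 * (box 3 n).card := by
  rw [card_box, card_box]; push_cast; ring

/-! ### First moment: pair connections versus a large piece -/

/-- **First moment ⇒ a large piece with positive probability.** For a probability measure `μ`, a
nonempty finite set `B` and events `E x y` (`x, y ∈ B`), write `N_x(ω) = #{y ∈ B : ω ∈ E x y}`. If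
`Σ_{x,y ∈ B} μ(E x y) ≥ η |B|²` then `μ(∃ u ∈ B, N_u ≥ (η/2)|B|) ≥ η/2`: indeed
`Σ_y μ(E x y) = ∫ N_x dμ ≤ (η/2)|B| + |B| μ(∃ u, N_u ≥ (η/2)|B|)` pointwise-integrated. [folklore] -/
theorem half_le_real_dense {Ω ι : Type*} [MeasurableSpace Ω] (μ : Measure Ω)
    [IsProbabilityMeasure μ] {B : Finset ι} (hB : B.Nonempty) (E : ι → ι → Set Ω)
    (hE : ∀ x ∈ B, ∀ y ∈ B, MeasurableSet (E x y)) {η : ℝ} (hη : 0 ≤ η)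
    (h : η * (B.card : ℝ) ^ 2 ≤ ∑ x ∈ B, ∑ y ∈ B, μ.real (E x y)) :
    η / 2 ≤ μ.real {ω | ∃ u ∈ B, η / 2 * (B.card : ℝ) ≤ ((B.filter fun y => ω ∈ E u y).card : ℝ)} := by
  -- the integral bookkeeping is adapted from `FreeBoxPowerSavingLine.LogBoost.sum_sum_measureReal_le`
  -- (Theorems/PercNonProliferationFreeBoxPowerSavingLogBoost.lean)
  set t : ℝ := η / 2 * (B.card : ℝ) with ht
  set QG : Set Ω := {ω | ∃ u ∈ B, t ≤ ((B.filter fun y => ω ∈ E u y).card : ℝ)} with hQG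
  have hcard : (0 : ℝ) < B.card := by exact_mod_cast hB.card_pos
  have ht0 : 0 ≤ t := by positivity
  have hN_eq : ∀ (x : ι) (ω : Ω), ((B.filter fun y => ω ∈ E x y).card : ℝ) =
      ∑ y ∈ B, (E x y).indicator (1 : Ω → ℝ) ω := by
    intro x ω
    rw [Finset.natCast_card_filter]
    refine Finset.sum_congr rfl fun y _ => ?_
    by_cases h : ω ∈ E x y <;> simp [h]
  have hN_meas : ∀ x ∈ B, Measurable fun ω => ((B.filter fun y => ω ∈ E x y).card : ℝ) := by
    intro x hx
    rw [show (fun ω => ((B.filter fun y => ω ∈ E x y).card : ℝ)) =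
        fun ω => ∑ y ∈ B, (E x y).indicator (1 : Ω → ℝ) ω from funext (hN_eq x)]
    exact Finset.measurable_sum _ fun y hy => measurable_one.indicator (hE x hx y hy)
  have hQG_meas : MeasurableSet QG := by
    rw [show QG = ⋃ u ∈ B, {ω | t ≤ ((B.filter fun y => ω ∈ E u y).card : ℝ)} by
      ext ω; simp [hQG]]
    exact Finset.measurableSet_biUnion _ fun u hu =>
      measurableSet_le measurable_const (hN_meas u hu)
  -- `Σ_y μ(E x y) ≤ t + |B| μ(QG)` for each `x ∈ B`
  have hx_bound : ∀ x ∈ B, ∑ y ∈ B, μ.real (E x y) ≤ t + (B.card : ℝ) * μ.real QG := by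
    intro x hx
    have hint : ∀ y ∈ B, Integrable ((E x y).indicator (1 : Ω → ℝ)) μ :=
      fun y hy => (integrable_const (1 : ℝ)).indicator (hE x hx y hy)
    have hI : Integrable (fun ω => (B.card : ℝ) * QG.indicator (1 : Ω → ℝ) ω) μ :=
      ((integrable_const (1 : ℝ)).indicator hQG_meas).const_mul _
    have hptw : ∀ ω, ∑ y ∈ B, (E x y).indicator (1 : Ω → ℝ) ω ≤
        t + (B.card : ℝ) * QG.indicator (1 : Ω → ℝ) ω := by
      intro ω
      rw [← hN_eq]
      by_cases hω : ω ∈ QG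
      · rw [Set.indicator_of_mem hω, Pi.one_apply, mul_one]
        have : ((B.filter fun y => ω ∈ E x y).card : ℝ) ≤ B.card := by
          exact_mod_cast Finset.card_filter_le _ _
        linarith
      · rw [Set.indicator_of_notMem hω, mul_zero, add_zero]
        exact (not_le.1 fun h => hω ⟨x, hx, h⟩).le
    calc ∑ y ∈ B, μ.real (E x y) = ∫ ω, ∑ y ∈ B, (E x y).indicator (1 : Ω → ℝ) ω ∂μ := by
          rw [integral_finsetSum _ hint]
          exact Finset.sum_congr rfl fun y hy => (integral_indicator_one (hE x hx y hy)).symm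
      _ ≤ ∫ ω, (t + (B.card : ℝ) * QG.indicator (1 : Ω → ℝ) ω) ∂μ :=
          integral_mono (integrable_finsetSum _ hint) ((integrable_const t).add hI) hptw
      _ = t + (B.card : ℝ) * μ.real QG := by
          rw [integral_add (integrable_const t) hI, integral_const, integral_const_mul,
            integral_indicator_one hQG_meas]
          simp
  have hsum : η * (B.card : ℝ) ^ 2 ≤ (B.card : ℝ) * (t + (B.card : ℝ) * μ.real QG) :=
    h.trans (by simpa only [Finset.sum_const, nsmul_eq_mul] using Finset.sum_le_sum hx_bound)
  by_contra hlt
  have h2 := mul_lt_mul_of_pos_right (not_le.1 hlt) (show (0 : ℝ) < (B.card : ℝ) ^ 2 by positivity)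
  rw [ht] at hsum
  nlinarith

/-! ### Boosting by independent sub-boxes -/

/-- **Boosting.** If `B(n)` has no free piece with `≥ t` vertices with probability `≤ θ`, then
`B((2j+1)n + j) ⊇ ⋃_{w ∈ B(j)} (B(n) + (2n+1)w)` has none with probability `≤ θ^{|B(j)|}`
(a piece of a sub-box lies in a piece of the box; the `|B(j)|` sub-box events are independent and
equiprobable). [folklore] -/
theorem real_compl_dense_bigBox_le (p : unitInterval) (n j : ℕ) (t : ℝ) {θ : ℝ}
    (hθ : (bondPercolation (zdGraph 3) p).real
      {ω | ∃ x ∈ box 3 n,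
        t ≤ (((box 3 n).filter fun v => ω ∈ openConnIn ↑(box 3 n) x v).card : ℝ)}ᶜ ≤ θ) :
    (bondPercolation (zdGraph 3) p).real
      {ω | ∃ x ∈ box 3 ((2 * j + 1) * n + j),
        t ≤ (((box 3 ((2 * j + 1) * n + j)).filter fun v =>
          ω ∈ openConnIn ↑(box 3 ((2 * j + 1) * n + j)) x v).card : ℝ)}ᶜ ≤ θ ^ (box 3 j).card := by
  calc (bondPercolation (zdGraph 3) p).real
        {ω | ∃ x ∈ box 3 ((2 * j + 1) * n + j),
          t ≤ (((box 3 ((2 * j + 1) * n + j)).filter fun v =>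
            ω ∈ openConnIn ↑(box 3 ((2 * j + 1) * n + j)) x v).card : ℝ)}ᶜ
      ≤ (bondPercolation (zdGraph 3) p).real (⋂ w ∈ box 3 j,
          {ω | ∃ x ∈ (box 3 n).image (· + fun i => (2 * (n : ℤ) + 1) * w i),
            t ≤ ((((box 3 n).image (· + fun i => (2 * (n : ℤ) + 1) * w i)).filter fun v =>
              ω ∈ openConnIn ↑((box 3 n).image (· + fun i => (2 * (n : ℤ) + 1) * w i)) x v).card :
                ℝ)}ᶜ) := by
        refine measureReal_mono (Set.subset_iInter₂ fun w hw => Set.compl_subset_compl.2 ?_)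
        exact dense_mono (image_box_add_subset hw) t
    _ = ∏ w ∈ box 3 j, (bondPercolation (zdGraph 3) p).real
          {ω | ∃ x ∈ (box 3 n).image (· + fun i => (2 * (n : ℤ) + 1) * w i),
            t ≤ ((((box 3 n).image (· + fun i => (2 * (n : ℤ) + 1) * w i)).filter fun v =>
              ω ∈ openConnIn ↑((box 3 n).image (· + fun i => (2 * (n : ℤ) + 1) * w i)) x v).card :
                ℝ)}ᶜ :=
        real_biInter_compl_dense (zdGraph 3) p (box 3 j)
          (fun w => (box 3 n).image (· + fun i => (2 * (n : ℤ) + 1) * w i))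
          (fun _ _ h => disjoint_image_box_add n h) t
    _ = ∏ _w ∈ box 3 j, (bondPercolation (zdGraph 3) p).real
          {ω | ∃ x ∈ box 3 n,
            t ≤ (((box 3 n).filter fun v => ω ∈ openConnIn ↑(box 3 n) x v).card : ℝ)}ᶜ :=
        Finset.prod_congr rfl fun w _ => real_compl_dense_image_add p _ (box 3 n) t
    _ = ((bondPercolation (zdGraph 3) p).real
          {ω | ∃ x ∈ box 3 n,
            t ≤ (((box 3 n).filter fun v => ω ∈ openConnIn ↑(box 3 n) x v).card : ℝ)}ᶜ) ^
          (box 3 j).card := Finset.prod_const _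
    _ ≤ θ ^ (box 3 j).card := pow_le_pow_left₀ measureReal_nonneg hθ _

/-- Union bound for an intersection: `P(A ∩ B) ≥ 1 - P(Aᶜ) - P(Bᶜ)`. [folklore] -/
theorem one_sub_le_real_inter {Ω : Type*} [MeasurableSpace Ω] (μ : Measure Ω)
    [IsProbabilityMeasure μ] {A B : Set Ω} (hA : MeasurableSet A) (hB : MeasurableSet B)
    {a b : ℝ} (ha : μ.real Aᶜ ≤ a) (hb : μ.real Bᶜ ≤ b) : 1 - (a + b) ≤ μ.real (A ∩ B) := by
  have h1 : μ.real (A ∩ B)ᶜ ≤ μ.real Aᶜ + μ.real Bᶜ := by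
    rw [Set.compl_inter]; exact measureReal_union_le _ _
  have h2 := probReal_compl_eq_one_sub (μ := μ) (hA.inter hB)
  linarith

end StubBoost

open StubBoost in
/-- **stub_boost (BOOSTED GIANTS; every `p`).** If `FA₂(p, n) = |Λ_n|⁻² Σ_{x,y} P_p(x ↔ y in Λ_n) ≥ η`
for infinitely many `n`, then for every `ε > 0` there is `δ > 0` such that, for infinitely many `n`
and all directions `i` at once, with `P_p`-probability `≥ 1 − ε` both `Λ_n` and `Λ_n + (2n+1)eᵢ`
contain a vertex whose free piece has `≥ δ |Λ_n|` vertices (first moment, boosting by `(2j+1)³`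
independent equiprobable sub-boxes of `Λ_N`, `N = (2j+1)n + j`, translation, union bound). [folklore] -/
theorem stub_boost :
    ∀ (p : unitInterval) (η : ℝ), 0 < η →
      (∃ᶠ n : ℕ in atTop, η ≤ (∑ x ∈ box 3 n, ∑ y ∈ box 3 n, (bondPercolation (zdGraph 3) p).real (openConnIn ↑(box 3 n) x y)) / ((box 3 n).card : ℝ) ^ 2) →
      ∀ ε : ℝ, 0 < ε → ∃ δ : ℝ, 0 < δ ∧ ∃ᶠ n : ℕ in atTop, ∀ i : Fin 3,
        1 - ε ≤ (bondPercolation (zdGraph 3) p).real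
          {ω | (∃ x ∈ box 3 n, δ * ((box 3 n).card : ℝ) ≤ ((((box 3 n).filter fun v => ω ∈ openConnIn ↑(box 3 n) x v)).card : ℝ)) ∧
            (∃ y ∈ ((box 3 n).image (· + (fun j : Fin 3 => if j = i then 2 * (n : ℤ) + 1 else 0))),
              δ * (((box 3 n).image (· + (fun j : Fin 3 => if j = i then 2 * (n : ℤ) + 1 else 0))).card : ℝ) ≤ (((((box 3 n).image (· + (fun j : Fin 3 => if j = i then 2 * (n : ℤ) + 1 else 0))).filter fun v => ω ∈ openConnIn ↑((box 3 n).image (· + (fun j : Fin 3 => if j = i then 2 * (n : ℤ) + 1 else 0))) y v)).card : ℝ))} := by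
  intro p η hη hfreq ε hε
  -- the decay rate `θ = max (1 - η/2) 0 < 1` and the boosting parameter `j = m`
  obtain ⟨m, hm⟩ : ∃ m : ℕ, (max (1 - η / 2) 0) ^ m < ε / 2 :=
    exists_pow_lt_of_lt_one (half_pos hε) (max_lt (by linarith) one_pos)
  have hmcard : m ≤ (box 3 m).card := by
    rw [card_box]; exact (show m ≤ 2 * m + 1 by omega).trans (Nat.le_self_pow three_ne_zero _)
  have hpow : (max (1 - η / 2) 0) ^ (box 3 m).card ≤ ε / 2 :=
    (pow_le_pow_of_le_one (le_max_right _ _) (max_le (by linarith) zero_le_one) hmcard).trans hm.le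
  refine ⟨η / (2 * (2 * (m : ℝ) + 1) ^ 3), by positivity, ?_⟩
  rw [Filter.frequently_atTop] at hfreq ⊢
  intro a
  obtain ⟨n, hna, hn⟩ := hfreq a
  set N : ℕ := (2 * m + 1) * n + m with hN
  refine ⟨N, hna.trans ?_, fun i => ?_⟩
  · calc n = 1 * n + 0 := by ring
      _ ≤ (2 * m + 1) * n + m := by gcongr <;> omega
  -- Step A: a piece of `B(n)` with `≥ (η/2)|B(n)|` vertices has probability `≥ η/2`
  have hcn : (0 : ℝ) < (box 3 n).card := by exact_mod_cast Finset.card_pos.2 (box_nonempty 3 n)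
  rw [le_div_iff₀ (by positivity)] at hn
  have hA := half_le_real_dense (bondPercolation (zdGraph 3) p) (box_nonempty 3 n)
    (openConnIn (↑(box 3 n) : Set (Site 3))) (fun x _ y _ => DCT16.measurableSet_openConnIn _ x y)
    hη.le hn
  set t : ℝ := η / 2 * ((box 3 n).card : ℝ) with ht
  -- Step F: the boosted box `B(N)`
  have hθ : (bondPercolation (zdGraph 3) p).real {ω | ∃ x ∈ box 3 n,
      t ≤ (((box 3 n).filter fun v => ω ∈ openConnIn ↑(box 3 n) x v).card : ℝ)}ᶜ ≤
      max (1 - η / 2) 0 := by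
    rw [probReal_compl_eq_one_sub (measurableSet_dense _ _)]
    exact le_trans (by linarith) (le_max_left _ _)
  have hF : (bondPercolation (zdGraph 3) p).real {ω | ∃ x ∈ box 3 N,
      t ≤ (((box 3 N).filter fun v => ω ∈ openConnIn ↑(box 3 N) x v).card : ℝ)}ᶜ ≤
      (max (1 - η / 2) 0) ^ (box 3 m).card :=
    real_compl_dense_bigBox_le p n m t hθ
  -- Step G: the adjacent translate `B(N) + (2N+1) eᵢ`
  have hG : (bondPercolation (zdGraph 3) p).real {ω | ∃ y ∈
      (box 3 N).image (· + fun j : Fin 3 => if j = i then 2 * (N : ℤ) + 1 else 0),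
      t ≤ ((((box 3 N).image (· + fun j : Fin 3 => if j = i then 2 * (N : ℤ) + 1 else 0)).filter
        fun v => ω ∈ openConnIn
          ↑((box 3 N).image (· + fun j : Fin 3 => if j = i then 2 * (N : ℤ) + 1 else 0)) y v).card :
            ℝ)}ᶜ ≤ (max (1 - η / 2) 0) ^ (box 3 m).card := by
    rw [real_compl_dense_image_add]; exact hF
  -- thresholds: `δ |B(N)| = δ |B(N) + (2N+1)eᵢ| = t`
  have hthr : η / (2 * (2 * (m : ℝ) + 1) ^ 3) * ((box 3 N).card : ℝ) = t := by
    rw [ht, hN, card_bigBox]; field_simp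
  rw [Finset.card_image_of_injective _ (add_left_injective _), hthr, Set.setOf_and]
  have hfin := one_sub_le_real_inter (bondPercolation (zdGraph 3) p) (measurableSet_dense _ t)
    (measurableSet_dense _ t) hF hG
  linarith

end Summit.CriticalPhenomena.PercolationContinuityZ3.Theorems.FreeBoxSparse

end
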